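import Summits.BirchSwinnertonDyer.Rank1Residual.GaloisImage.KolyvaginSystemsCoreRankZeroTorsion
import Summits.BirchSwinnertonDyer.Rank1Residual.GaloisImage.KummerSelfDualCount
import HarnessLib

/-!
# `KS₁(E[p], 𝓚, 𝒫) = 0` for the classical (`p`-descent, Kummer) Selmer structure of an elliptic
# curve, `p` odd: the core rank of `𝓚` is zero by residual self-duality
# (cell `b2b-bsdres`, team n1011, ROUTE-1 item R1-16, file 5 — the annex-X1 clause
# "`KS(E[3], 𝓕_cl) = 0`" of `cells/n1011/ROUTE-1.md` §18 made kernel-expressible; seat p11)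

HONEST FRAMING (verbatim for the cell): research route; prove what is provable now; shrink each hard
class to its core with data; no claim beyond stated classes; nothing booked; no mark / label moved.
ONE theorem, no definition, no named fact, no conjecture node.  CONDITIONAL (binders, all printed
or structural): a Poitou–Tate family `inv` (`IsPerfect`, `SumLocalTermEqZero`, `SelmerComplement` —
the tree's fact `poitouTate_selmerStructure_duality`), Tate's local Euler–Poincaré characteristic
formula at the finite places (`hEP`, named fact `localEulerPoincareCharacteristic`, as in
`KummerSelfDualCount.lean`), finiteness of the `p`-Selmer group `H¹_𝓚(K, E[p]) = Sel^{(p)}(E/K)`,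
`𝓚` unramified outside `S` (X11b `KummerDuality.kummerSelmerStructure_isUnramifiedOutside`), the
local shape of the Kolyvagin primes (Rubin PCMI Prop. 1.9.5 (1) / Ex. 1.9.7; cell row T-R1-16-LOC),
admissible comparison maps (row T-HCC) and the prime choice `hC55` in the shape of Sakamoto, JTNB
36 (2024) Cor. 5.5 (typer backlog TB-S24C55).

The point (Sakamoto, arXiv:2106.03370v2 §5.2, before Rem. 5.6: "Note that residual self-duality
implies that `χ(𝒢) = 0`", for the classical structure `𝒢 = 𝓕_cl`): the Kummer structure
`𝓚 = kummerSelmerStructure p` on `E[p]` is residually SELF-DUAL under the Weil pairing, so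
`#H¹_𝓚(K, E[p]) = #H¹_{𝓚^*}(K, E[p]^D)` — n1011-p13's `natCard_selmerGroup_kummer_eq_dual`
(`KummerSelfDualCount.lean`), i.e. `χ(𝓚) = 0` (`HasCoreRank inv 𝓚 p 0`) — and the core-rank-zero
vanishing theorem (`torsion_kolyvaginSystems_eq_bot_of_hasCoreRank_zero`, Rubin PCMI Thm. 2.7.6 at
`m = 1` = Mazur–Rubin Thm. 4.2.2) gives `KS₁(E[p], 𝓚, 𝒫) = 0` for every Kolyvagin datum `𝒫` on
`E[p]` with Rubin's local shape.  In words: there is no non-zero Kolyvagin system for the classical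
Selmer structure itself; the Kolyvagin system of Kato's Euler system lives in `KS₁` of Mazur–Rubin's
`𝓕_can`, which is `𝓚` RELAXED at the places above `p` (core rank one, Sakamoto 2024 Thm. 4.4) — the
subject of the cell's row T-a3-F1, not of this file.

References: [Rubin2011] Thm. 2.7.6 (p. 24); [Sakamoto2024] §3.1.2, Def. 3.6, Cor. 5.5 (p. 929);
[MilneADT2006] I Thm. 2.8, Cor. 3.4; [SilvermanAEC2009] Prop. III.8.1.
-/

noncomputable section

open scoped Classical NumberField ContRepresentation
open Function NumberField IsDedekindDomain WeierstrassCurve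
open Literature.NumberTheory.EllipticCurves
open Literature.NumberTheory.GaloisRepresentations Literature.NumberTheory.GaloisRepresentations.DiscreteGaloisModule
  Literature.NumberTheory.GaloisCohomology

universe u

namespace Summit.BirchSwinnertonDyer.Rank1Residual.GaloisImage.CoreRankZero

variable {K : Type u} [Field K] [NumberField K]

/-- **`KS₁(E[p], 𝓚, 𝒫) = 0` for the Kummer (classical `p`-descent) Selmer structure, `p` an odd
prime**: `χ(𝓚) = 0` by the residual self-duality count `#H¹_𝓚(K, E[p]) = #H¹_{𝓚^*}(K, E[p]^D)`
(n1011-p13's `natCard_selmerGroup_kummer_eq_dual`, from the Weil pairing — Silverman III.8.1, the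
tree's `exists_weilPairing_holds` — and Tate's local Euler characteristic `hEP`), then the
core-rank-zero vanishing theorem `torsion_kolyvaginSystems_eq_bot_of_hasCoreRank_zero` (Rubin PCMI
Thm. 2.7.6 at `m = 1`).  Binders: the Poitou–Tate family; `hEP`; `S ⊇ ∞ ∪ {v ∣ p} ∪ Ram(E[p])` with
`𝓚` unramified outside `S`; `Sel^{(p)}(E/K)` finite; the datum's primes outside `S` with Rubin's
local shape (`hU`, `hT`, `hUT`), admissible comparison maps (`hadm`), and the prime choice `hC55`
(Sakamoto 2024 Cor. 5.5 shape).  Nothing about any particular curve is asserted.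
[cite: Rubin2011, Thm. 2.7.6 (p. 24)] [cite: Sakamoto2024, Def. 3.6 (p. 923) and Cor. 5.5 (p. 929)]
[cite: MilneADT2006, Ch. I, Thm. 2.8] -/
theorem kummer_kolyvaginSystems_eq_bot (W : WeierstrassCurve K) [W.IsElliptic]
    (p : ℕ) [Fact p.Prime] (hp2 : p ≠ 2) [Finite (geomTorsion W (p : ℤ))]
    {inv : LocalInvariants K p}
    (hperf : inv.IsPerfect) (hsum : inv.SumLocalTermEqZero) (hcompl : inv.SelmerComplement)
    (hEP : ∀ v : HeightOneSpectrum (𝓞 K), localEulerPoincareCharacteristic (v.adicCompletion K))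
    {S : Finset (Place K)}
    (hS : ∀ v : HeightOneSpectrum (𝓞 K), (Sum.inr v : Place K) ∉ S →
      ((p : ℕ) : 𝓞 K) ∉ v.asIdeal ∧ GaloisRep.IsUnramifiedAt v (W.torsionGaloisModule (p : ℤ)))
    (h𝓚 : (W.kummerSelmerStructure (p : ℤ)).IsUnramifiedOutside S)
    [hfin : Finite (W.kummerSelmerStructure (p : ℤ)).selmerGroup]
    {D : KolyvaginDatum (W.torsionGaloisModule (p : ℤ))}
    (hPS : ∀ q ∈ D.primes, (Sum.inr q : Place K) ∉ S) (hadm : D.IsAdmissible)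
    (hU : ∀ q ∈ D.primes,
      Nat.card (unramifiedSubgroup (GaloisRep.toLocal q (W.torsionGaloisModule (p : ℤ))) 1) = p)
    (hT : ∀ q ∈ D.primes, Nat.card (D.transverse (Sum.inr q)) = p)
    (hUT : ∀ q ∈ D.primes,
      unramifiedSubgroup (GaloisRep.toLocal q (W.torsionGaloisModule (p : ℤ))) 1 ⊔
        D.transverse (Sum.inr q) = ⊤)
    (hC55 : ∀ c₁ c₂ c₃ : galoisCohomology (W.torsionGaloisModule (p : ℤ)) 1, c₁ ≠ 0 → c₂ ≠ 0 →
      c₃ ≠ 0 →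
      {q ∈ D.primes |
        galoisCohomology.localization (W.torsionGaloisModule (p : ℤ)) (Sum.inr q) 1 c₁ ≠ 0 ∧
        galoisCohomology.localization (W.torsionGaloisModule (p : ℤ)) (Sum.inr q) 1 c₂ ≠ 0 ∧
        galoisCohomology.localization (W.torsionGaloisModule (p : ℤ)) (Sum.inr q) 1 c₃ ≠ 0}.Infinite) :
    D.kolyvaginSystems (W.kummerSelmerStructure (p : ℤ)) = ⊥ := by
  have hp : p.Prime := Fact.out
  haveI : NeZero p := ⟨hp.ne_zero⟩
  obtain ⟨e, hμ, hadd₁, hadd₂, halt, hnondeg, hgal⟩ :=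
    exists_weilPairing_holds W p hp.two_le (Nat.cast_ne_zero.2 hp.ne_zero)
  have hinv : ∀ v : HeightOneSpectrum (𝓞 K), Injective (inv (Sum.inr v)) := fun v => (hperf v).1.1
  -- `χ(𝓚) = 0`: the residual self-duality count
  have hcount := natCard_selmerGroup_kummer_eq_dual W p e hμ hadd₁ hadd₂ hgal halt hnondeg hp.isPrimePow
    (hp.odd_of_ne_two hp2) inv hinv hEP
  have hχ : LocalInvariants.HasCoreRank inv (W.kummerSelmerStructure (p : ℤ)) p 0 := by
    rw [LocalInvariants.HasCoreRank, pow_zero, one_mul]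
    exact hcount
  -- the dual Selmer group is finite (same cardinality as the finite `Sel^{(p)}`)
  have hfind : Finite (inv.dualSelmerStructure (W.torsionGaloisModule (p : ℤ))
      (W.kummerSelmerStructure (p : ℤ))).selmerGroup := by
    apply Nat.finite_of_card_ne_zero
    rw [← hcount]
    exact Nat.card_pos.ne'
  exact torsion_kolyvaginSystems_eq_bot_of_hasCoreRank_zero W p hperf hsum hcompl hS h𝓚 hfin hfind hχ
    hPS hadm hU hT hUT hC55

end Summit.BirchSwinnertonDyer.Rank1Residual.GaloisImage.CoreRankZero

end
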